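import Summits.Ventures.CertifiedManyBodySolver.Observables.StiffnessApexTransportTargetSlot
import HarnessLib

/-!
# Ventures/CertifiedManyBodySolver — Observables/StiffnessApexTransportCurtainTargetSlot.lean

HONEST FRAMING: one-sided certified CEILINGS on the uniform flux stiffness (`t–t′` f-sum class) at ANY density, transported into a `(t′, U)` box
from a «curtain» of sources each read at the TARGET's own hopping slot — NO `K₂` input, no lever; a ceiling never speaks to the presence of order;
not a `T_c` estimate, not a superconductivity verdict; every leaf is CONDITIONAL on the families it names. Zero compute, no definition, no `sorry`.

Cell `pub/hubbard-downfold` (D-0150 L-DF2 «box ↦ one word»; D-0154 doped coverage boxes), seat `hubbard-downfold-unc-2`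
(`prover-hubbard-downfold-unc-2-g15-0`); the doped, lever-free edition of the curtain master of `Observables/StiffnessApexTransportCurtain.lean`
(bottom inner segment + left edge to `U_L` + short overhang at `U_L`) on the target-slot point engine of `…TargetSlot.lean`. In `…CurtainDoped` every
curtain family carried a `K₂` floor and a lever `≤ min(q − p, (−p)(1 − U_A/U_max))`; here each family is two-parametric — (slot `σ`, source) — and the
slot is the target's, so the lever vanishes at every density. By `orbitLower_slot_chord_of_two_endObjectives` (the f-sum orbit mean is affine in the
slot) such a family is what TWO ordinary single-objective bundles — end objectives `−X₀(p)`, `−X₀(q)` — deliver on each curtain piece: bottom `t′`-bundle,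
left-edge `U`-bundle(s), overhang `t′`-bundle, each vertex read twice.

* `ObsStiffnessSeqCeilingAt_on_box_of_curtain_targetSlot` — THE TARGET-SLOT CURTAIN (any `0 ≤ n < 2`): BOTTOM family `valB σ s` (`σ ∈ [p,q]`, `s ∈ [p, σ]`,
  classes at `(s, U_A)`), LEFT family `valL σ U'` (`σ ∈ [p,q]`, `U' ∈ [U_A, U_L]`, classes at `(p, U')`), OVERHANG family `valO σ s` (`σ ∈ [p,q]`,
  `s ∈ [p(2 − U_L/U_max), p]`, classes at `(s, U_L)`), all for the objective `−X₀(σ)` at the family's `U`, with `−val ≤ c` ⇒ the whole box. (The slot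
  ranges are rectangular supersets of the pairs actually used; with two end-objective reads every `σ ∈ [p, q]` is available anyway.)
* `…_on_box_of_bottomEdge_and_leftEdge_targetSlot` — (E2) the «L» at any density, lever-free.

References: T. Koma, H. Tasaki, J. Stat. Phys. 76 (1994) 745, §1 [KomaTasaki1994]; D. J. Scalapino, S. R. White, S.-C. Zhang, PRB 47 (1993)
7995, §II [ScalapinoWhiteZhang1993].
-/

noncomputable section

namespace Summit.Ventures.CertifiedManyBodySolver.Observables

open Literature.MathematicalPhysics.QuantumLattice
open Literature.MathematicalPhysics.QuantumLattice.ThermodynamicLimit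
open Literature.MathematicalPhysics.QuantumFieldTheory
open Literature.Probability.LatticeModels
open Matrix Finset Filter Topology HubbardWave0
open scoped Matrix BigOperators ComplexOrder

section Curtain

variable {UA UL Umax p q n : ℝ}

/-- **THE TARGET-SLOT CURTAIN (any density, no `K₂` input).** Box `[p, q] × [U_A, U_max]`, `q ≤ 0 < U_A ≤ U_L`, density `0 ≤ n < 2`. Three two-parameter
unconditional orbit-lower families for the objective `−X₀(σ, ·)` at the TARGET slot `σ ∈ [p, q]`: (BOTTOM) `valB σ s` on the classes at `(s, U_A)`,
`s ∈ [p, σ]`; (LEFT) `valL σ U'` on the classes at `(p, U')`, `U' ∈ [U_A, U_L]`; (OVERHANG at `U_L`) `valO σ s` on the classes at `(s, U_L)`,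
`s ∈ [p(2 − U_L/U_max), p]`; with `−valB σ s ≤ c`, `−valL σ U' ≤ c`, `−valO σ s ≤ c`. Then `ObsStiffnessSeqCeilingAt t′ U n c` at EVERY point of the box —
routing as in the half-filling curtain (bottom if the apex segment meets it inside `[p, q]`, else the left edge at `U' = U(2 − p/t′)` if `U' ≤ U_L`, else the
overhang at height `U_L`), each source read at the slot `σ = t′` (`ObsStiffnessSeqCeilingAt_of_apexSource_targetSlot_orbitLower`): NO lever, NO `K₂` word.
[cite: KomaTasaki1994, §1] [cite: ScalapinoWhiteZhang1993, §II] -/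
theorem ObsStiffnessSeqCeilingAt_on_box_of_curtain_targetSlot (hUA : 0 < UA) (hAL : UA ≤ UL) (hq : q ≤ 0) (hn0 : 0 ≤ n) (hn2 : n < 2)
    (valB valL valO : ℝ → ℝ → ℝ) (c : ℚ)
    (hB : ∀ σ ∈ Set.Icc p q, ∀ s ∈ Set.Icc p σ,
      ∀ (ω : InfVolFermionState 2) (Ls : ℕ → ℕ) (ψ : ∀ L, Fock (Orb (FermionTorus 2 L))),
      Tendsto Ls atTop atTop →
      (∀ j, IsGroundStateInSector (hubbardTorusTT' (Ls j) 1 s UA) (rectN n (Ls j)) 0 (ψ (Ls j))) →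
      (∀ j, star (ψ (Ls j)) ⬝ᵥ ψ (Ls j) = 1) → ω.IsTorusLimitOf ψ Ls →
      valB σ s ≤ ((Finset.univ : Finset (DihedralGroup 4)).card : ℝ)⁻¹ * ∑ g ∈ (Finset.univ : Finset (DihedralGroup 4)),
        (ω.expect (d4ShiftSet g 0 (box 2 7)) (fermionEmbed (PolySite.d4Emb g 0 (box 2 7)) (-oddMomentObsTT σ UA 0))).re)
    (hcB : ∀ σ ∈ Set.Icc p q, ∀ s ∈ Set.Icc p σ, -valB σ s ≤ ((c : ℚ) : ℝ))
    (hL : ∀ σ ∈ Set.Icc p q, ∀ U' ∈ Set.Icc UA UL,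
      ∀ (ω : InfVolFermionState 2) (Ls : ℕ → ℕ) (ψ : ∀ L, Fock (Orb (FermionTorus 2 L))),
      Tendsto Ls atTop atTop →
      (∀ j, IsGroundStateInSector (hubbardTorusTT' (Ls j) 1 p U') (rectN n (Ls j)) 0 (ψ (Ls j))) →
      (∀ j, star (ψ (Ls j)) ⬝ᵥ ψ (Ls j) = 1) → ω.IsTorusLimitOf ψ Ls →
      valL σ U' ≤ ((Finset.univ : Finset (DihedralGroup 4)).card : ℝ)⁻¹ * ∑ g ∈ (Finset.univ : Finset (DihedralGroup 4)),
        (ω.expect (d4ShiftSet g 0 (box 2 7)) (fermionEmbed (PolySite.d4Emb g 0 (box 2 7)) (-oddMomentObsTT σ U' 0))).re)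
    (hcL : ∀ σ ∈ Set.Icc p q, ∀ U' ∈ Set.Icc UA UL, -valL σ U' ≤ ((c : ℚ) : ℝ))
    (hO : ∀ σ ∈ Set.Icc p q, ∀ s ∈ Set.Icc (p * (2 - UL / Umax)) p,
      ∀ (ω : InfVolFermionState 2) (Ls : ℕ → ℕ) (ψ : ∀ L, Fock (Orb (FermionTorus 2 L))),
      Tendsto Ls atTop atTop →
      (∀ j, IsGroundStateInSector (hubbardTorusTT' (Ls j) 1 s UL) (rectN n (Ls j)) 0 (ψ (Ls j))) →
      (∀ j, star (ψ (Ls j)) ⬝ᵥ ψ (Ls j) = 1) → ω.IsTorusLimitOf ψ Ls →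
      valO σ s ≤ ((Finset.univ : Finset (DihedralGroup 4)).card : ℝ)⁻¹ * ∑ g ∈ (Finset.univ : Finset (DihedralGroup 4)),
        (ω.expect (d4ShiftSet g 0 (box 2 7)) (fermionEmbed (PolySite.d4Emb g 0 (box 2 7)) (-oddMomentObsTT σ UL 0))).re)
    (hcO : ∀ σ ∈ Set.Icc p q, ∀ s ∈ Set.Icc (p * (2 - UL / Umax)) p, -valO σ s ≤ ((c : ℚ) : ℝ)) :
    ∀ tp ∈ Set.Icc p q, ∀ U ∈ Set.Icc UA Umax, ObsStiffnessSeqCeilingAt tp U n c := by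
  intro tp htp U hU
  have hUP : 0 < U := hUA.trans_le hU.1
  have hUne : U ≠ 0 := hUP.ne'
  have htp0 : tp ≤ 0 := htp.2.trans hq
  by_cases hsA : p ≤ tp * (2 * U - UA) / U
  · -- (BOTTOM) source `s = t′(2U − U_A)/U ∈ [p, t′]`, slot `t′`
    have hsle : tp * (2 * U - UA) / U ≤ tp :=
      (apexSource_mem_Icc_of_slab (p := tp) (q := tp) hUA hU.1 hU.2 htp0 ⟨le_rfl, le_rfl⟩).2
    have hmem : tp * (2 * U - UA) / U ∈ Set.Icc p tp := ⟨hsA, hsle⟩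
    have hapexB : U * (tp * (2 * U - UA) / U) = (2 * U - UA) * tp := by
      rw [mul_div_assoc', mul_div_cancel_left₀ _ hUne]; ring
    exact ObsStiffnessSeqCeilingAt_of_apexSource_targetSlot_orbitLower UA (valB tp (tp * (2 * U - UA) / U)) hUA.le hU.1 hUP hapexB
      hn0 hn2 (hB tp htp _ hmem) c (hcB tp htp _ hmem)
  · have hsA : tp * (2 * U - UA) / U < p := not_le.mp hsA
    have ht0 : tp < 0 := by
      rcases htp0.eq_or_lt with h0 | h0
      · exfalso
        rw [h0, zero_mul, zero_div] at hsA
        exact absurd (htp.1.trans_eq h0) (not_le.2 hsA)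
      · exact h0
    obtain ⟨hU'le, hapexL⟩ := leftEdge_apexSource htp.1 ht0 hUP
    have hU'gt : UA < U * (2 - p / tp) := (apexSource_lt_iff_station_lt_leftEdge ht0 hUP).1 hsA
    by_cases hUL : U * (2 - p / tp) ≤ UL
    · -- (LEFT EDGE) source `(p, U')`, slot `t′`
      have hmem : U * (2 - p / tp) ∈ Set.Icc UA UL := ⟨hU'gt.le, hUL⟩
      exact ObsStiffnessSeqCeilingAt_of_apexSource_targetSlot_orbitLower (U * (2 - p / tp)) (valL tp (U * (2 - p / tp)))
        (hUA.le.trans hU'gt.le) hU'le hUP hapexL hn0 hn2 (hL tp htp _ hmem) c (hcL tp htp _ hmem)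
    · -- (OVERHANG at `U_L`) source `(s_L, U_L)`, slot `t′`
      have hUL : UL < U * (2 - p / tp) := not_le.mp hUL
      have hLU : UL ≤ U := hUL.le.trans hU'le
      have hL0 : 0 < UL := hUA.trans_le hAL
      have hsL : tp * (2 * U - UL) / U < p := (apexSource_lt_iff_station_lt_leftEdge ht0 hUP).2 hUL
      have hmem : tp * (2 * U - UL) / U ∈ Set.Icc (p * (2 - UL / Umax)) p :=
        ⟨(apexSource_mem_Icc_of_slab (p := p) hL0 hLU hU.2 hq htp).1, hsL.le⟩
      have hapexO : U * (tp * (2 * U - UL) / U) = (2 * U - UL) * tp := by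
        rw [mul_div_assoc', mul_div_cancel_left₀ _ hUne]; ring
      exact ObsStiffnessSeqCeilingAt_of_apexSource_targetSlot_orbitLower UL (valO tp (tp * (2 * U - UL) / U)) hL0.le hLU hUP hapexO
        hn0 hn2 (hO tp htp _ hmem) c (hcO tp htp _ hmem)

/-- **(E2) THE «L» AT ANY DENSITY, LEVER-FREE.** Box `[p, q] × [U_A, U_max]` (`q ≤ 0 < U_A ≤ U_max`), `0 ≤ n < 2`: the BOTTOM target-slot family `valB σ s`
(`σ ∈ [p,q]`, `s ∈ [p, σ]`, classes at `(s, U_A)`) and the LEFT-EDGE target-slot family `valL σ U'` (`σ ∈ [p,q]`, `U' ∈ [U_A, U_max]`, classes at `(p, U')`),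
both for `−X₀(σ, ·)` with `−val ≤ c`, give `ObsStiffnessSeqCeilingAt t′ U n c` on the whole box; no source outside the box, no `K₂` input.
[cite: KomaTasaki1994, §1] [cite: ScalapinoWhiteZhang1993, §II] -/
theorem ObsStiffnessSeqCeilingAt_on_box_of_bottomEdge_and_leftEdge_targetSlot (hUA : 0 < UA) (hUmax : UA ≤ Umax) (hq : q ≤ 0)
    (hn0 : 0 ≤ n) (hn2 : n < 2) (valB valL : ℝ → ℝ → ℝ) (c : ℚ)
    (hB : ∀ σ ∈ Set.Icc p q, ∀ s ∈ Set.Icc p σ,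
      ∀ (ω : InfVolFermionState 2) (Ls : ℕ → ℕ) (ψ : ∀ L, Fock (Orb (FermionTorus 2 L))),
      Tendsto Ls atTop atTop →
      (∀ j, IsGroundStateInSector (hubbardTorusTT' (Ls j) 1 s UA) (rectN n (Ls j)) 0 (ψ (Ls j))) →
      (∀ j, star (ψ (Ls j)) ⬝ᵥ ψ (Ls j) = 1) → ω.IsTorusLimitOf ψ Ls →
      valB σ s ≤ ((Finset.univ : Finset (DihedralGroup 4)).card : ℝ)⁻¹ * ∑ g ∈ (Finset.univ : Finset (DihedralGroup 4)),
        (ω.expect (d4ShiftSet g 0 (box 2 7)) (fermionEmbed (PolySite.d4Emb g 0 (box 2 7)) (-oddMomentObsTT σ UA 0))).re)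
    (hcB : ∀ σ ∈ Set.Icc p q, ∀ s ∈ Set.Icc p σ, -valB σ s ≤ ((c : ℚ) : ℝ))
    (hL : ∀ σ ∈ Set.Icc p q, ∀ U' ∈ Set.Icc UA Umax,
      ∀ (ω : InfVolFermionState 2) (Ls : ℕ → ℕ) (ψ : ∀ L, Fock (Orb (FermionTorus 2 L))),
      Tendsto Ls atTop atTop →
      (∀ j, IsGroundStateInSector (hubbardTorusTT' (Ls j) 1 p U') (rectN n (Ls j)) 0 (ψ (Ls j))) →
      (∀ j, star (ψ (Ls j)) ⬝ᵥ ψ (Ls j) = 1) → ω.IsTorusLimitOf ψ Ls →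
      valL σ U' ≤ ((Finset.univ : Finset (DihedralGroup 4)).card : ℝ)⁻¹ * ∑ g ∈ (Finset.univ : Finset (DihedralGroup 4)),
        (ω.expect (d4ShiftSet g 0 (box 2 7)) (fermionEmbed (PolySite.d4Emb g 0 (box 2 7)) (-oddMomentObsTT σ U' 0))).re)
    (hcL : ∀ σ ∈ Set.Icc p q, ∀ U' ∈ Set.Icc UA Umax, -valL σ U' ≤ ((c : ℚ) : ℝ)) :
    ∀ tp ∈ Set.Icc p q, ∀ U ∈ Set.Icc UA Umax, ObsStiffnessSeqCeilingAt tp U n c := by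
  -- the target-slot curtain with `U_L = U_max`: the overhang degenerates to the corner `(p, U_max)`, a left-edge source
  have hmax : 0 < Umax := hUA.trans_le hUmax
  have h2 : p * (2 - Umax / Umax) = p := by rw [div_self hmax.ne']; ring
  refine ObsStiffnessSeqCeilingAt_on_box_of_curtain_targetSlot hUA hUmax hq hn0 hn2 valB valL (fun σ _ => valL σ Umax) c hB hcB hL hcL
    (fun σ hσ s hs => ?_) (fun σ hσ s hs => ?_)
  · rw [h2] at hs
    have hsp : s = p := le_antisymm hs.2 hs.1
    subst hsp
    exact hL σ hσ Umax ⟨hUmax, le_rfl⟩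
  · exact hcL σ hσ Umax ⟨hUmax, le_rfl⟩

end Curtain

end Summit.Ventures.CertifiedManyBodySolver.Observables

end
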